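import Mathlib
import Summits.Ventures.HodgeRepro2.T5AdicCompletionRelativeDuality
import Summits.Ventures.HodgeRepro2.T5BallAnnihilator

/-!
# Lemma N5.L5's bookkeeping at an inert place: `ψ_δ = ψ₀(t·)` with `v_E(t) = d_v + 1`

At an INERT quadratic place (`ϖ ∈ O_Kv` irreducible, staying irreducible in `O_Lw`) the valuation of
`Lw` restricts to that of `Kv` (`w(alg x) = v x`, ramification index `1`).  For `ψ₀ : AddChar Lw Circle`
of exact conductor `c₀` and `t ∈ Kv`, `t ≠ 0`:

* `val_algebraMap_eq`: `w (alg x) = v x`;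
* `conductorExp_mulShift_algebraMap`: `n(ψ₀(t·)) = c₀ − log (v t)` (Lemma N5.L4(i) + inertness);
* `exists_unique_log_val_eq`: for `χ` continuous, trivial on `Kv`, of exact conductor `d`, the unique
  `t ∈ Kv` with `χ = ψ₀(t·)` (`T5AdicCompletionRelativeDuality`, `ψ₀ = ofBase (1, δ) ψ_F`) has
  `log (v t) = c₀ − d` — Lemma N5.L5's «`n(ψ₀(t·)) = n(ψ₀) + v_E(t)` gives `v_E(t) = d_v + 1`»
  (`c₀ = −1`, `d = d_v`, `v_E(t) = −log (v t)`).

Declaration per README §8(d): «uses an L-value-free non-vanishing device: NO».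
-/

namespace Summit.Ventures.HodgeRepro2.T5InertConductorShift

open IsDedekindDomain HeightOneSpectrum WithZero T5CharactersTrivialOnBase T5AdditiveConductor

variable {K : Type*} [Field K] [NumberField K] (v : HeightOneSpectrum (NumberField.RingOfIntegers K))
  {L : Type*} [Field L] [NumberField L] [Algebra K L]
  (w : HeightOneSpectrum (NumberField.RingOfIntegers L)) [w.asIdeal.LiesOver v.asIdeal]

/-- At an inert place `w (alg x) = v x` (ramification index `1`). -/
theorem val_algebraMap_eq {ϖ : adicCompletionIntegers K v} (hϖ : Irreducible ϖ)
    (hϖS : Irreducible (algebraMap (adicCompletionIntegers K v) (adicCompletionIntegers L w) ϖ))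
    (x : adicCompletion K v) :
    Valued.v (algebraMap (adicCompletion K v) (adicCompletion L w) x) = Valued.v x := by
  have h := T5AdicCompletionIntegral.val_algebraMap_eq_pow v w
    ((T5AdicCompletionConductor.irreducible_iff_val_eq_exp_neg_one v ϖ).1 hϖ) (e := 1) one_pos
    (by rw [T5UnramifiedCharacter.val_algebraMap_eq_exp_neg_one v w hϖS]; norm_num) x
  rw [h, pow_one]

/-- `n(ψ₀(t·)) = c₀ − log (v t)` for `t ∈ Kv`, `t ≠ 0`, `ψ₀` of exact conductor `c₀` on `Lw`. -/
theorem conductorExp_mulShift_algebraMap {ϖ : adicCompletionIntegers K v} (hϖ : Irreducible ϖ)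
    (hϖS : Irreducible (algebraMap (adicCompletionIntegers K v) (adicCompletionIntegers L w) ϖ))
    (ψ₀ : AddChar (adicCompletion L w) Circle) {c₀ : ℤ}
    (h1 : ∀ y : adicCompletion L w, Valued.v y ≤ exp c₀ → ψ₀ y = 1)
    (h2 : ∃ y : adicCompletion L w, Valued.v y ≤ exp (c₀ + 1) ∧ ψ₀ y ≠ 1)
    {t : adicCompletion K v} (ht : t ≠ 0) :
    conductorExp (ψ₀.mulShift (algebraMap (adicCompletion K v) (adicCompletion L w) t))
      (Valued.v : Valuation (adicCompletion L w) ℤᵐ⁰) = c₀ - (Valued.v t).log := by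
  have ht' : algebraMap (adicCompletion K v) (adicCompletion L w) t ≠ 0 :=
    (map_ne_zero _).2 ht
  rw [T5BallAnnihilator.conductorExp_mulShift_eq ψ₀ h1 h2 ht', val_algebraMap_eq v w hϖ hϖS]

/-- Lemma N5.L5's bookkeeping: `χ` continuous, trivial on `Kv`, of exact conductor `d`; then the unique
`t ∈ Kv` with `χ = ψ₀(t·)` (`ψ₀ = ofBase (1, δ) ψ_F` of exact conductor `c₀`) satisfies
`log (v t) = c₀ − d`, i.e. «`v_E(t) = d_v + 1`» for `c₀ = −1`. -/
theorem exists_unique_log_val_eq {ϖ : adicCompletionIntegers K v} (hϖ : Irreducible ϖ)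
    (hϖS : Irreducible (algebraMap (adicCompletionIntegers K v) (adicCompletionIntegers L w) ϖ))
    (b : Module.Basis (Fin 2) (adicCompletion K v) (adicCompletion L w)) (hb : b 0 = 1)
    (ψF : AddChar (adicCompletion K v) Circle) (hψc : Continuous ψF) (hψ : ψF ≠ 1) {c₀ : ℤ}
    (h1 : ∀ y : adicCompletion L w, Valued.v y ≤ exp c₀ → ofBase b ψF y = 1)
    (h2 : ∃ y : adicCompletion L w, Valued.v y ≤ exp (c₀ + 1) ∧ ofBase b ψF y ≠ 1)
    (χ : AddChar (adicCompletion L w) Circle) (hχc : Continuous χ)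
    (hχ : ∀ a : adicCompletion K v, χ (algebraMap _ _ a) = 1) {d : ℤ}
    (hd1 : ∀ y : adicCompletion L w, Valued.v y ≤ exp d → χ y = 1)
    (hd2 : ∃ y : adicCompletion L w, Valued.v y ≤ exp (d + 1) ∧ χ y ≠ 1) :
    ∃! t : adicCompletion K v,
      (∀ y : adicCompletion L w, χ y = ofBase b ψF (algebraMap _ _ t * y)) ∧
        (Valued.v t).log = c₀ - d := by
  obtain ⟨t, ht, huniq⟩ :=
    T5AdicCompletionRelativeDuality.existsUnique_forall_eq_ofBase_mul v w b hb ψF hψc hψ χ hχc hχ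
  have ht0 : t ≠ 0 := by
    rintro rfl
    obtain ⟨y, _, hy⟩ := hd2
    apply hy
    rw [ht y, map_zero, zero_mul, AddChar.map_zero_eq_one]
  have hχeq : χ = (ofBase b ψF).mulShift (algebraMap (adicCompletion K v) (adicCompletion L w) t) :=
    AddChar.ext _ _ fun y => by rw [AddChar.mulShift_apply, ht y]
  have hcond : conductorExp χ (Valued.v : Valuation (adicCompletion L w) ℤᵐ⁰) = d :=
    conductorExp_eq_of χ _ d hd1 (fun h => by
      obtain ⟨y, hy, hy1⟩ := hd2
      exact hy1 (h y hy)) (by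
      obtain ⟨y, _, hy1⟩ := hd2
      exact ⟨y, hy1⟩)
  have hlog : (Valued.v t).log = c₀ - d := by
    have := conductorExp_mulShift_algebraMap v w hϖ hϖS (ofBase b ψF) h1 h2 ht0
    rw [← hχeq, hcond] at this
    omega
  exact ⟨t, ⟨ht, hlog⟩, fun t' ht' => huniq t' ht'.1⟩

end Summit.Ventures.HodgeRepro2.T5InertConductorShift
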